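import Literature.Computability.Complexity.OracleClockFst
import HarnessLib

/-!
# The idle clock of an oracle algorithm: stop emulating, keep the run unfinished (transcript model)

Trunk `CplxCore`, companion of `OracleQueryMap.lean` (`OracleAlg.clock`) and
`OracleClockFst.lean` (`OracleAlg.clockBy`, `OracleAlg.clockFst`). Those clocks OUTPUT a default
`b₀` once the budget `t w` is spent, so the clocked algorithm halts against every oracle — the
right normal form for deciders. For an EXACT emulation of a budgeted run one needs the other
behaviour past the clock: `M` run with `t w` rounds of fuel yields `none` when it has not halted
by then, and an emulation inside a larger fuel budget must then yield `none` too, not a default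
output (the output law `OracleAdversary.outputPMF` of `Cryptography/OracleGames.lean`
distinguishes `none` from every `some b`; consumer: the preprocessing closure of PPT oracle
adversaries, `Cryptography/OracleAdversaryPrecomp.lean`). This file provides the
none-preserving twin of `clockBy`/`clockFst`:

* `OracleAlg.idleClockBy M t` — behave as `M` for `t w` rounds, then IDLE (ask the dummy query
  `[]` for ever, never output); `runAux_idleClockBy`, `run_idleClockBy`: with fuel `n ≥ t w` the
  idly clocked algorithm outputs EXACTLY `M.run O (t w) w` (`none` included);
* `OracleAlg.idleClockFst M q := idleClockBy fun w => q(|(boolUnpair w).1|)` and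
  `isPolyTime_idleClockFst`: polynomial time is preserved (the stage decomposition of
  `OracleQueryMap.lean` with the test `cClkFst q` of `OracleClockFst.lean`; only the constant of
  the idle branch, the code `[0]` of the query `[]`, differs from `ClockFstPoly.GClkFst`).

## References

* S. Arora, B. Barak, *Computational Complexity: A Modern Approach*, CUP 2009, §3.4 (oracle
  machines) with §1.4.1 (clocked simulation: time bounds enforced by a counter), Thm. 2.8
  (proof: composition of polynomial-time maps).
-/

namespace Literature.Computability.Complexity

open _root_.Computability PrePost EmptySim

namespace OracleAlg

variable {β : Type}

/-! ### The idle clock by an arbitrary bound -/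

section IdleClockBy

/-- **The algorithm idly clocked by `t`**: `M.idleClockBy t` behaves as `M` for `t w` rounds on
input `w` and then idles — it asks the dummy query `[]` in every later round and never outputs.
(Arora–Barak 2009, §3.4 with §1.4.1: a clocked simulation; here the exhausted simulation is
reported as "no output" rather than by a default value, cf. `OracleAlg.clockBy`.)
[cite: AroraBarakCC2009, §3.4 with §1.4.1] -/
def idleClockBy (M : OracleAlg β) (t : List Bool → ℕ) : OracleAlg β where
  step w as := if as.length < t w then M.step w as else Sum.inl []

/-- The step of `M.idleClockBy t` (definitional). [folklore] -/
theorem idleClockBy_step (M : OracleAlg β) (t : List Bool → ℕ) (w : List Bool)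
    (as : List (List Bool)) :
    (M.idleClockBy t).step w as = if as.length < t w then M.step w as else Sum.inl [] :=
  rfl

/-- Past the clock the idly clocked algorithm never outputs. [folklore] -/
theorem runAux_idleClockBy_of_le (M : OracleAlg β) (t : List Bool → ℕ) (O : Oracle) (w : List Bool) :
    ∀ (n : ℕ) (as : List (List Bool)), t w ≤ as.length → (M.idleClockBy t).runAux O w n as = none
  | 0, _, _ => rfl
  | n + 1, as, h => by
    rw [runAux_succ, idleClockBy_step, if_neg (Nat.not_lt.2 h)]
    exact runAux_idleClockBy_of_le M t O w n _ (by simp; omega)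

/-- **The output of the idly clocked algorithm.** Along a transcript growing by one answer per
round, with at least as much fuel as the clock leaves, `M.idleClockBy t` runs EXACTLY as `M`
with the remaining `t w - |as|` rounds (so it yields `none` if `M` does not halt by then).
[cite: AroraBarakCC2009, §3.4 with §1.4.1] -/
theorem runAux_idleClockBy (M : OracleAlg β) (t : List Bool → ℕ) (O : Oracle) (w : List Bool) :
    ∀ (n : ℕ) (as : List (List Bool)), as.length ≤ t w → t w - as.length ≤ n →
      (M.idleClockBy t).runAux O w n as = M.runAux O w (t w - as.length) as
  | 0, as, _, h => by
    rw [Nat.le_zero.1 h]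
    rfl
  | n + 1, as, hle, hn => by
    rw [runAux_succ, idleClockBy_step]
    by_cases hc : as.length < t w
    · rw [if_pos hc]
      obtain ⟨m, hm⟩ : ∃ m, t w - as.length = m + 1 := ⟨t w - as.length - 1, by omega⟩
      rw [hm, runAux_succ]
      cases M.step w as with
      | inr b => rfl
      | inl y =>
        have h1 : (as ++ [O y]).length ≤ t w := by simp; omega
        have h2 : t w - (as ++ [O y]).length ≤ n := by simp; omega
        have h3 : t w - (as ++ [O y]).length = m := by simp; omega
        dsimp only
        rw [runAux_idleClockBy M t O w n _ h1 h2, h3]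
    · rw [if_neg hc]
      have h0 : t w - as.length = 0 := by omega
      rw [h0, runAux_zero]
      exact runAux_idleClockBy_of_le M t O w n _ (by simp; omega)

/-- **`M.idleClockBy t` with fuel `n ≥ t w` outputs exactly `M.run O (t w) w`.**
[cite: AroraBarakCC2009, §3.4 with §1.4.1] -/
theorem run_idleClockBy (M : OracleAlg β) (t : List Bool → ℕ) (O : Oracle) (w : List Bool)
    {n : ℕ} (hn : t w ≤ n) : (M.idleClockBy t).run O n w = M.run O (t w) w := by
  have h := runAux_idleClockBy M t O w n [] (Nat.zero_le _) (by simpa using hn)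
  simpa [run] using h

end IdleClockBy

/-! ### The idle clock by the first component of the input -/

section IdleClockFst

/-- **Idle clock by the first field**: `M.idleClockFst q` behaves as `M` for `q(|x|)` rounds on an
input `w = ⟨x, r⟩` (`x = (boolUnpair w).1`) and then idles — the exact re-clocking of an oracle
adversary, whose round budget is a polynomial in the game input `x` while its step function reads
`⟨x, coins⟩` (cf. `OracleAlg.clockFst`). [cite: AroraBarakCC2009, §3.4 with §1.4.1] -/
def idleClockFst (M : OracleAlg β) (q : Polynomial ℕ) : OracleAlg β :=
  M.idleClockBy fun w => q.eval (boolUnpair w).1.length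

/-- The step of `M.idleClockFst q` (definitional). [folklore] -/
theorem idleClockFst_step (M : OracleAlg β) (q : Polynomial ℕ) (w : List Bool) (as : List (List Bool)) :
    (M.idleClockFst q).step w as =
      if as.length < q.eval (boolUnpair w).1.length then M.step w as else Sum.inl [] :=
  rfl

/-- **Output of `M.idleClockFst q` on a pair input** `⟨x, r⟩` with fuel `n ≥ q(|x|)`: exactly
`M.run O (q |x|) ⟨x, r⟩`. [cite: AroraBarakCC2009, §3.4 with §1.4.1] -/
theorem run_idleClockFst_boolPair (M : OracleAlg β) (q : Polynomial ℕ) (O : Oracle) (x r : List Bool)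
    {n : ℕ} (hn : q.eval x.length ≤ n) :
    (M.idleClockFst q).run O n (boolPair x r) = M.run O (q.eval x.length) (boolPair x r) := by
  have h := run_idleClockBy M (fun w => q.eval (boolUnpair w).1.length) O (boolPair x r)
    (n := n) (by simpa using hn)
  simpa [idleClockFst] using h

end IdleClockFst

/-! ### Polynomial time -/

section PolyTime

variable (eb : Encoding β Bool)

namespace IdleClockPoly

open QueryMapPoly ClockFstPoly

/-- Stage C of the idle first-field clock (typed): keep the step result while `|as| < q(|x|)`,
`x = (boolUnpair w).1`, else ask the dummy query `[]`. [folklore] -/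
def stIdleFst (q : Polynomial ℕ) (r : (List Bool ⊕ β) × (List Bool × List (List Bool))) :
    List Bool ⊕ β :=
  if r.2.2.length < q.eval (boolUnpair r.2.1).1.length then r.1 else Sum.inl []

/-- The step of `M.idleClockFst q` factors through the stages of `OracleQueryMap.lean`. [folklore] -/
theorem uncurry_idleClockFst_step (M : OracleAlg β) (q : Polynomial ℕ) :
    Function.uncurry (M.idleClockFst q).step =
      stIdleFst q ∘ Prod.map (Function.uncurry M.step) id ∘ fun p : St => (p, p) := by
  funext p
  obtain ⟨x, as⟩ := p
  simp only [Function.uncurry_apply_pair, Function.comp_apply, stIdleFst, Prod.map_apply, id,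
    idleClockFst_step]

/-- Stage C of the idle first-field clock as a string map: the test `cClkFst q` of
`OracleClockFst.lean`, the step result, or the code `[0]` of the dummy query `Sum.inl []`.
[folklore] -/
noncomputable def GIdleFst (q : Polynomial ℕ) : List (Option Bool) → List Bool :=
  iteFn (cClkFst q ∘ fun z => (boolUnpair z).2) (fun z => (boolUnpair z).1)
    (fun _ => ((encodingList Bool).sumBool eb).encode (Sum.inl [])) ∘ fromField.eval

/-- **Stage C of the idle first-field clock is polynomial-time.** [cite: AroraBarakCC2009, Thm. 2.8 (proof)] -/
theorem polyTime_stIdleFst (q : Polynomial ℕ) :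
    PolyTimeComputable (encQ eb) ((encodingList Bool).sumBool eb).encode (stIdleFst (β := β) q) := by
  have hW : (iteFn (cClkFst q ∘ fun z => (boolUnpair z).2) (fun z => (boolUnpair z).1)
      (fun _ => ((encodingList Bool).sumBool eb).encode (Sum.inl ([] : List Bool)))) ∈ FP :=
    iteFn_mem_FP (comp_mem_FP (cClkFst_mem_FP q) boolUnpairSnd_mem_FP) boolUnpairFst_mem_FP
      (const_mem_FP _)
  have hS : PolyTimeComputable (id : List (Option Bool) → _) (id : List Bool → List Bool)
      (GIdleFst eb q) :=
    PolyTimeComputable.comp_holds hW fromField.polyTimeComputable_eval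
  refine PolyTimeComputable.of_encode hS (encQ eb) (fun _ => rfl) fun r => ?_
  obtain ⟨r, x, as⟩ := r
  have hin : encIn (x, as) = boolPair x ((encodingList Bool).listBool.encode as) := rfl
  simp only [id, GIdleFst, Function.comp_apply, encQ, fromField_eval, hin, stIdleFst]
  by_cases hc : as.length < q.eval (boolUnpair x).1.length
  · rw [iteFn_apply_true (by rw [Function.comp_apply, boolUnpair_boolPair, cClkFst_apply]; simp [hc]),
      if_pos hc, boolUnpair_boolPair]
  · rw [iteFn_apply_false (by rw [Function.comp_apply, boolUnpair_boolPair, cClkFst_apply]; simp [hc]),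
      if_neg hc]

end IdleClockPoly

open QueryMapPoly IdleClockPoly

/-- **`M.idleClockFst q` is polynomial-time** when `M` is. [cite: AroraBarakCC2009, §3.4 with §1.4.1 and Thm. 2.8 (proof)] -/
theorem isPolyTime_idleClockFst {M : OracleAlg β} (hM : M.IsPolyTime eb) (q : Polynomial ℕ) :
    (M.idleClockFst q).IsPolyTime eb := by
  unfold IsPolyTime
  rw [uncurry_idleClockFst_step]
  exact PolyTimeComputable.comp_holds (polyTime_stIdleFst eb q)
    (PolyTimeComputable.comp_holds (polyTime_stB eb hM) polyTime_stageA)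

end PolyTime

end OracleAlg

end Literature.Computability.Complexity
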